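import Literature.AnabelianGeometry.EtaleTheta.Discharge.Sec1Prop15iiSchema
import HarnessLib

/-!
# [EtTh] Prop. 1.5 (i) ↔ (ii): the clause links between the two FACT rows F-2502 `Prop15i` and F-2503
# `Prop15ii` over ONE Kummer datum (proof-only companion of `ThetaCohomology.lean`)

Mochizuki, *The étale theta function …*, Publ. RIMS **45** (2009) [EtTh], §1, Prop. 1.5 "(Theta Cohomology)",
PRIMS PDF p. 23 (printed 249) [cite: MochizukiEtTh2009, Prop 1.5 p.23]: (i) "`F⁰/F¹ = Hom(Δ_Θ, Δ_Θ) = Ẑ·log(Θ)`;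
`F¹/F² = … = Ẑ·log(U)`; `F² = H¹(G_K, Δ_Θ) →̃ (K^×)^∧`" on `Y`; (ii) the same on `Ÿ` "where we write
`log(Ü) := ½·log(U)`".

PROOF-ONLY file (abc-iut cell, block F fact-proving wave, seat abc-iut-f-140, tranche 140 = FACT-LIST rows
**F-2502** `Literature.AnabelianGeometry.EtaleTheta.ThetaSetting.Prop15i` and **F-2503** `….Prop15ii`; no
definition, no instance, no `Prop` fact; imports, never edits, abc-iut-L2-t1's `ThetaCohomology.lean`).  The
universal closures of both rows are already settled in the kernel (abc-iut-f-117: `forall_prop15i_iff_isEmpty_kummerData`,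
`forall_prop15ii_iff_isEmpty_kummerData`, files `Sec1Prop15Schema.lean` / `Sec1Prop15iiSchema.lean`).  What this
file adds is the DEPENDENCY between the two rows when they are bound, as the consumers do, for ONE Kummer datum
`K : D.KummerData` over one `hC : D.Compat` — relevant to any certificate that lists both as hypotheses and to the
model-side discharge (R78 / R179), where each clause must be established once, not twice:

* `res_deltaTheta_Y_eq_res_res` — restriction `H¹((Π^tp_Y)^Θ, Δ_Θ) → H¹(Δ_Θ, Δ_Θ)` factors through
  `H¹((Π^tp_Ÿ)^Θ, Δ_Θ)` (`ContH1.res_res`);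
* clause (a): `res_deltaTheta_surjective_Ydd_of_Y` — "`F⁰/F¹ = Hom(Δ_Θ, Δ_Θ)`" on `Y` IMPLIES
  "`F̈⁰/F̈¹ = Hom(Δ_Θ, Δ_Θ)`" on `Ÿ` (for every theta setting, no guard);
* clause (b): `KummerData.logU_mem_F1_iff_res_logUdd_sq` — by the interface law `res_logU : log(U)|_Ÿ = 2·log(Ü)`,
  `log(U) ∈ F¹ ↔ (log(Ü)|_{Δ_Θ})² = 1`; hence `logU_mem_F1_of_logUdd_mem_Fdd1` (no guard) and, under the origin
  guard `IsEtThOrigin` (no `2`-torsion in `H¹(Δ_Θ, Δ_Θ)`, abc-iut-f-117's `h1Theta_deltaTheta_eq_one_of_pow_eq_one`),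
  `logUdd_mem_Fdd1_of_logU_mem_F1`; together `logU_mem_F1_iff_logUdd_mem_Fdd1` — the (b)-clauses of the two
  rows are EQUIVALENT;
* packaging: `KummerData.prop15ii_of_prop15i` — at an origin setting, `Prop15i K hC` plus the single `Ÿ`-side
  clause `F̈² = range (kumYdd)` gives `Prop15ii K hC`; `Prop15ii.logU_mem_F1'` — conversely (ii) returns
  (i)'s clause (b).  The two `F²`-clauses ((i)(c) on `Y`, (ii)(c) on `Ÿ`) are independent data of the
  interface and are not related here (recorded, not claimed).

HONEST FRAMING: statements about the TYPED predicates over the abstract interface; the printed Prop. 1.5 is a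
theorem about the tempered fundamental group of a once-punctured elliptic curve and is neither asserted nor
denied; a FACT row is an assumption label; no side taken on [IUTchIII] Cor. 3.12; typed ≠ proved.
-/

noncomputable section

namespace Literature.AnabelianGeometry.EtaleTheta

namespace ThetaSetting

variable {p : ℕ} [Fact p.Prime] {D : ThetaSetting p}

/-! ### Restriction to `Δ_Θ` from `Y` factors through `Ÿ` -/

/-- The restriction `H¹((Π^tp_Y)^Θ, Δ_Θ) → H¹(Δ_Θ, Δ_Θ)` (whose kernel is `F¹`) is the composite of the
restriction to `(Π^tp_Ÿ)^Θ` and the restriction `H¹((Π^tp_Ÿ)^Θ, Δ_Θ) → H¹(Δ_Θ, Δ_Θ)` (whose kernel is `F̈¹`).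
[cite: MochizukiEtTh2009, Prop 1.5 (ii) p.23] -/
theorem res_deltaTheta_Y_eq_res_res (hC : D.Compat) (x : D.H1Theta (D.GtpY.map D.toTheta)) :
    ContH1.res (MonoidHom.id D.GtpTheta) D.DeltaTheta
        (hC.deltaTheta_le_DtpYTheta.trans (Subgroup.map_mono inf_le_left)) x =
      ContH1.res (MonoidHom.id D.GtpTheta) D.DeltaTheta
        (hC.deltaTheta_le_DtpYddTheta.trans (Subgroup.map_mono inf_le_left))
        (ContH1.res (MonoidHom.id D.GtpTheta) D.DeltaTheta D.GtpYddTheta_le x) := by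
  have h12 : D.DeltaTheta ≤ D.GtpYdd.map D.toTheta :=
    hC.deltaTheta_le_DtpYddTheta.trans (Subgroup.map_mono inf_le_left)
  have key := ContH1.res_res (φ := MonoidHom.id D.GtpTheta) (A := D.DeltaTheta) h12 D.GtpYddTheta_le x
  exact key.symm

/-! ### Clause (a): `F⁰/F¹ = Hom(Δ_Θ, Δ_Θ)` on `Y` implies the same on `Ÿ` -/

/-- **Prop. 1.5 (i)(a) ⇒ (ii)(a).** If restriction `H¹((Π^tp_Y)^Θ, Δ_Θ) → H¹(Δ_Θ, Δ_Θ)` is surjective (clause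
`res_deltaTheta_surjective` of `Prop15i`), then so is `H¹((Π^tp_Ÿ)^Θ, Δ_Θ) → H¹(Δ_Θ, Δ_Θ)` (the same clause of
`Prop15ii`): the former factors through the latter. [cite: MochizukiEtTh2009, Prop 1.5 (ii) p.23] -/
theorem res_deltaTheta_surjective_Ydd_of_Y (hC : D.Compat)
    (h : Function.Surjective
      (ContH1.res (MonoidHom.id D.GtpTheta) D.DeltaTheta
        (hC.deltaTheta_le_DtpYTheta.trans (Subgroup.map_mono inf_le_left)) :
        D.H1Theta (D.GtpY.map D.toTheta) → D.H1Theta D.DeltaTheta)) :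
    Function.Surjective
      (ContH1.res (MonoidHom.id D.GtpTheta) D.DeltaTheta
        (hC.deltaTheta_le_DtpYddTheta.trans (Subgroup.map_mono inf_le_left)) :
        D.H1Theta (D.GtpYdd.map D.toTheta) → D.H1Theta D.DeltaTheta) := by
  intro c
  obtain ⟨x, rfl⟩ := h c
  exact ⟨ContH1.res (MonoidHom.id D.GtpTheta) D.DeltaTheta D.GtpYddTheta_le x,
    (res_deltaTheta_Y_eq_res_res hC x).symm⟩

/-- The same, read on the rows: `Prop15i K hC` yields the surjectivity clause of `Prop15ii` (for any Kummer
datum, no origin guard). [cite: MochizukiEtTh2009, Prop 1.5 (ii) p.23] -/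
theorem Prop15i.res_deltaTheta_surjective_Ydd {K : D.KummerData} {hC : D.Compat} (h : Prop15i K hC) :
    Function.Surjective
      (ContH1.res (MonoidHom.id D.GtpTheta) D.DeltaTheta
        (hC.deltaTheta_le_DtpYddTheta.trans (Subgroup.map_mono inf_le_left)) :
        D.H1Theta (D.GtpYdd.map D.toTheta) → D.H1Theta D.DeltaTheta) :=
  res_deltaTheta_surjective_Ydd_of_Y hC h.res_deltaTheta_surjective

/-! ### Clause (b): `log(U) ∈ F¹` versus `log(Ü) ∈ F̈¹` -/

namespace KummerData

variable (K : D.KummerData)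

/-- **`log(U) ∈ F¹ ↔ (log(Ü)|_{Δ_Θ})² = 1`**, from the interface law `log(U)|_Ÿ = 2·log(Ü)` (`res_logU`) and the
factorisation of restriction through `Ÿ`. [cite: MochizukiEtTh2009, Prop 1.5 (ii) p.23] -/
theorem logU_mem_F1_iff_res_logUdd_sq (hC : D.Compat) :
    K.logU ∈ F1 hC ↔
      ContH1.res (MonoidHom.id D.GtpTheta) D.DeltaTheta
          (hC.deltaTheta_le_DtpYddTheta.trans (Subgroup.map_mono inf_le_left)) K.logUdd ^ 2 = 1 := by
  have key : ContH1.res (MonoidHom.id D.GtpTheta) D.DeltaTheta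
        (hC.deltaTheta_le_DtpYTheta.trans (Subgroup.map_mono inf_le_left)) K.logU =
      ContH1.res (MonoidHom.id D.GtpTheta) D.DeltaTheta
          (hC.deltaTheta_le_DtpYddTheta.trans (Subgroup.map_mono inf_le_left)) K.logUdd ^ 2 := by
    rw [res_deltaTheta_Y_eq_res_res hC, K.res_logU]
    exact map_pow _ _ _
  simp only [F1, MonoidHom.mem_ker, key]

/-- **Prop. 1.5 (ii)(b) ⇒ (i)(b)** for the same Kummer datum, unconditionally: `log(Ü) ∈ F̈¹` implies
`log(U) ∈ F¹` (`log(U)|_{Δ_Θ} = (log(Ü)|_{Δ_Θ})² = 1`). [cite: MochizukiEtTh2009, Prop 1.5 (i) p.23] -/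
theorem logU_mem_F1_of_logUdd_mem_Fdd1 (hC : D.Compat) (h : K.logUdd ∈ Fdd1 hC) : K.logU ∈ F1 hC := by
  rw [logU_mem_F1_iff_res_logUdd_sq]
  have h' : ContH1.res (MonoidHom.id D.GtpTheta) D.DeltaTheta
      (hC.deltaTheta_le_DtpYddTheta.trans (Subgroup.map_mono inf_le_left)) K.logUdd = 1 := h
  rw [h', one_pow]

/-- **Prop. 1.5 (i)(b) ⇒ (ii)(b)** for the same Kummer datum, under the origin guard: `log(U) ∈ F¹` gives
`(log(Ü)|_{Δ_Θ})² = 1`, and `H¹(Δ_Θ, Δ_Θ)` has no `2`-torsion (`Δ_Θ` centralises itself and is torsion-free,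
abc-iut-f-117 `h1Theta_deltaTheta_eq_one_of_pow_eq_one`), so `log(Ü) ∈ F̈¹`.
[cite: MochizukiEtTh2009, Prop 1.5 (ii) p.23] -/
theorem logUdd_mem_Fdd1_of_logU_mem_F1 (hC : D.Compat) (hO : D.IsEtThOrigin) (h : K.logU ∈ F1 hC) :
    K.logUdd ∈ Fdd1 hC :=
  D.h1Theta_deltaTheta_eq_one_of_pow_eq_one hO two_ne_zero _ ((K.logU_mem_F1_iff_res_logUdd_sq hC).1 h)

/-- **The (b)-clauses of F-2502 and F-2503 are equivalent** (same Kummer datum, origin setting):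
`log(U) ∈ F¹ ↔ log(Ü) ∈ F̈¹`. [cite: MochizukiEtTh2009, Prop 1.5 p.23] -/
theorem logU_mem_F1_iff_logUdd_mem_Fdd1 (hC : D.Compat) (hO : D.IsEtThOrigin) :
    K.logU ∈ F1 hC ↔ K.logUdd ∈ Fdd1 hC :=
  ⟨K.logUdd_mem_Fdd1_of_logU_mem_F1 hC hO, K.logU_mem_F1_of_logUdd_mem_Fdd1 hC⟩

/-! ### Packaging on the rows -/

/-- **F-2502 ⇒ F-2503 modulo the `Ÿ`-side `F̈²`-clause.** At an origin setting, `Prop15i K hC` together with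
"`F̈² = H¹(G_K̈, Δ_Θ) ≅ (K̈^×)^∧`" (`Fdd2 = range K.kumYdd`, the one clause of (ii) that is independent interface
data) yields `Prop15ii K hC`. [cite: MochizukiEtTh2009, Prop 1.5 (ii) p.23] -/
theorem prop15ii_of_prop15i (hC : D.Compat) (hO : D.IsEtThOrigin) (h : Prop15i K hC)
    (hF2 : (Fdd2 : Subgroup (D.H1Theta (D.GtpYdd.map D.toTheta))) = K.kumYdd.range) :
    Prop15ii K hC :=
  ⟨h.res_deltaTheta_surjective_Ydd, K.logUdd_mem_Fdd1_of_logU_mem_F1 hC hO h.logU_mem_F1, hF2⟩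

end KummerData

/-- **F-2503 ⇒ clause (b) of F-2502**: `Prop15ii K hC` gives `log(U) ∈ F¹` for the same datum (no guard).
[cite: MochizukiEtTh2009, Prop 1.5 (i) p.23] -/
theorem Prop15ii.logU_mem_F1' {K : D.KummerData} {hC : D.Compat} (h : Prop15ii K hC) : K.logU ∈ F1 hC :=
  K.logU_mem_F1_of_logUdd_mem_Fdd1 hC h.logUdd_mem_Fdd1

/-- **Joint form.** At an origin setting, for one Kummer datum the conjunction `Prop15i K hC ∧ Prop15ii K hC`
is equivalent to `Prop15i K hC` plus the single clause `F̈² = range (kumYdd)` — binding both rows as separate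
hypotheses double-counts clauses (a) and (b) of (ii). [cite: MochizukiEtTh2009, Prop 1.5 p.23] -/
theorem prop15i_and_prop15ii_iff (K : D.KummerData) (hC : D.Compat) (hO : D.IsEtThOrigin) :
    (Prop15i K hC ∧ Prop15ii K hC) ↔
      (Prop15i K hC ∧ (Fdd2 : Subgroup (D.H1Theta (D.GtpYdd.map D.toTheta))) = K.kumYdd.range) :=
  ⟨fun h => ⟨h.1, h.2.Fdd2_eq⟩, fun h => ⟨h.1, K.prop15ii_of_prop15i hC hO h.1 h.2⟩⟩

end ThetaSetting

end Literature.AnabelianGeometry.EtaleTheta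

end
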